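import Mathlib
import Summits.ValiantsHypothesis.ValiantsHypothesis.Theorems.RigidityForcesSymmetryRankRigidMinimalReprLaplaceFiveStarT2Relations
import Summits.ValiantsHypothesis.ValiantsHypothesis.Theorems.RigidityForcesSymmetryRankRigidMinimalReprLaplaceFiveStarPatternCubic

/-!
# ValiantsHypothesis / RigidityForcesSymmetry — crux `LaplaceOptimalFive` (stmt-ValiantsHypothesis-24813), crux idea
`young-shadow` (K1) on the star: **ASSEMBLY TOOLS** — the pattern tensor, the letter slack, letter → polynomial relations
(memo `NOTE-p4g16-24813-LemmaK-kernel.md` r2 §4 (iv))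

* `pattern_symm34/45`, `pattern_rep`, `pattern_zero_of_collision`, `pattern_one` — the pattern `P₅(A,…,E) = [letters distinct]`;
* `exists_complement_triple` — two distinct letters extend to five distinct letters covering `Fin 5`;
* `antisym_of_pattern_relations` — `Σ_{AB} s_{AB}P₅(A,B,C,D,E) = 0` for all `C,D,E` forces `s_{AB}+s_{BA} = 0`
  (✓ `pairSum_pattern_eval`);
* `slack_symm34/45` — the letter slack `E = H − (1/10)S_H` is symmetric in its last three slots;
* `slack_annihilated_of_binary` — for a T2 two-term `H`, `E` is annihilated in its third slot by `{e,f}^⊥`;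
* `poly_relation_of_letter_relation` — a letter relation of `P₅ + 4E` is the polynomial relation
  `Σ C(s_{AB})((A≠B ? x^{{A,B}ᶜ} : 0) + (2/3)E_{AB}) = 0` of ✓ `offDiag_relations_fine` (✓ `pattern_cubic`).

No definitions, no `sorry`.  Honest framing: wiring brick, closes nothing; K1-on-the-star PAPER PASS, not kernel;
`LaplaceOptimalFive` OPEN · CONTESTED 72/120; `VP ≠ VNP` NOT proved.
-/

set_option linter.dupNamespace false

namespace Summit.ValiantsHypothesis.ValiantsHypothesis.Theorems.RigidityForcesSymmetryRankRigidMinimalRepr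

namespace LaplaceFiveStar

open Finset MvPolynomial

/-! ### The pattern tensor -/

/-- Swap of the letters `C, D` in the pattern. [folklore] -/
theorem pattern_symm34 (A B C D E : Fin 5) :
    (if (A ≠ B ∧ A ≠ C ∧ A ≠ D ∧ A ≠ E ∧ B ≠ C ∧ B ≠ D ∧ B ≠ E ∧ C ≠ D ∧ C ≠ E ∧ D ≠ E) then (1 : ℂ) else 0)
      = (if (A ≠ B ∧ A ≠ D ∧ A ≠ C ∧ A ≠ E ∧ B ≠ D ∧ B ≠ C ∧ B ≠ E ∧ D ≠ C ∧ D ≠ E ∧ C ≠ E) then (1 : ℂ) else 0) := by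
  by_cases h : (A ≠ B ∧ A ≠ C ∧ A ≠ D ∧ A ≠ E ∧ B ≠ C ∧ B ≠ D ∧ B ≠ E ∧ C ≠ D ∧ C ≠ E ∧ D ≠ E)
  · obtain ⟨h1, h2, h3, h4, h5, h6, h7, h8, h9, h10⟩ := h
    rw [if_pos ⟨h1, h2, h3, h4, h5, h6, h7, h8, h9, h10⟩, if_pos ⟨h1, h3, h2, h4, h6, h5, h7, Ne.symm h8, h10, h9⟩]
  · rw [if_neg h, if_neg]
    rintro ⟨h1, h3, h2, h4, h6, h5, h7, h8, h10, h9⟩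
    exact h ⟨h1, h2, h3, h4, h5, h6, h7, Ne.symm h8, h9, h10⟩

/-- Swap of the letters `D, E` in the pattern. [folklore] -/
theorem pattern_symm45 (A B C D E : Fin 5) :
    (if (A ≠ B ∧ A ≠ C ∧ A ≠ D ∧ A ≠ E ∧ B ≠ C ∧ B ≠ D ∧ B ≠ E ∧ C ≠ D ∧ C ≠ E ∧ D ≠ E) then (1 : ℂ) else 0)
      = (if (A ≠ B ∧ A ≠ C ∧ A ≠ E ∧ A ≠ D ∧ B ≠ C ∧ B ≠ E ∧ B ≠ D ∧ C ≠ E ∧ C ≠ D ∧ E ≠ D) then (1 : ℂ) else 0) := by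
  by_cases h : (A ≠ B ∧ A ≠ C ∧ A ≠ D ∧ A ≠ E ∧ B ≠ C ∧ B ≠ D ∧ B ≠ E ∧ C ≠ D ∧ C ≠ E ∧ D ≠ E)
  · obtain ⟨h1, h2, h3, h4, h5, h6, h7, h8, h9, h10⟩ := h
    rw [if_pos ⟨h1, h2, h3, h4, h5, h6, h7, h8, h9, h10⟩, if_pos ⟨h1, h2, h4, h3, h5, h7, h6, h9, h8, Ne.symm h10⟩]
  · rw [if_neg h, if_neg]
    rintro ⟨h1, h2, h4, h3, h5, h7, h6, h9, h8, h10⟩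
    exact h ⟨h1, h2, h3, h4, h5, h6, h7, h8, h9, Ne.symm h10⟩

/-- The pattern vanishes on a repeated letter in slots `3,4`. [folklore] -/
theorem pattern_rep (A B C E : Fin 5) :
    (if (A ≠ B ∧ A ≠ C ∧ A ≠ C ∧ A ≠ E ∧ B ≠ C ∧ B ≠ C ∧ B ≠ E ∧ C ≠ C ∧ C ≠ E ∧ C ≠ E) then (1 : ℂ) else 0) = 0 := by
  rw [if_neg]
  rintro ⟨-, -, -, -, -, -, -, h, -, -⟩
  exact h rfl

/-- The pattern vanishes when one of the first two letters collides. [folklore] -/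
theorem pattern_zero_of_collision (x y c d e : Fin 5) (h : x = y ∨ x = c ∨ x = d ∨ x = e ∨ y = c ∨ y = d ∨ y = e) :
    (if (x ≠ y ∧ x ≠ c ∧ x ≠ d ∧ x ≠ e ∧ y ≠ c ∧ y ≠ d ∧ y ≠ e ∧ c ≠ d ∧ c ≠ e ∧ d ≠ e) then (1 : ℂ) else 0) = 0 := by
  rw [if_neg]
  rintro ⟨h1, h2, h3, h4, h5, h6, h7, -, -, -⟩
  rcases h with h | h | h | h | h | h | h
  · exact h1 h
  · exact h2 h
  · exact h3 h
  · exact h4 h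
  · exact h5 h
  · exact h6 h
  · exact h7 h

/-- Two distinct letters extend to five distinct letters covering `Fin 5`. [folklore] -/
theorem exists_complement_triple (a b : Fin 5) (hab : a ≠ b) :
    ∃ c d e : Fin 5, a ≠ c ∧ a ≠ d ∧ a ≠ e ∧ b ≠ c ∧ b ≠ d ∧ b ≠ e ∧ c ≠ d ∧ c ≠ e ∧ d ≠ e ∧
      ∀ i : Fin 5, i = a ∨ i = b ∨ i = c ∨ i = d ∨ i = e := by
  classical
  have hR : ((Finset.univ.erase a).erase b).card = 3 := by
    rw [Finset.card_erase_of_mem (by simp [Ne.symm hab]), Finset.card_erase_of_mem (Finset.mem_univ _)]; simp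
  obtain ⟨k, l, m, hkl, hkm, hlm, hRe⟩ := Finset.card_eq_three.mp hR
  have memR : ∀ z : Fin 5, z ∈ (Finset.univ.erase a).erase b ↔ z ≠ b ∧ z ≠ a := fun z => by simp [Finset.mem_erase]
  have hk : k ≠ b ∧ k ≠ a := (memR k).mp (by rw [hRe]; simp)
  have hl : l ≠ b ∧ l ≠ a := (memR l).mp (by rw [hRe]; simp)
  have hm : m ≠ b ∧ m ≠ a := (memR m).mp (by rw [hRe]; simp)
  refine ⟨k, l, m, Ne.symm hk.2, Ne.symm hl.2, Ne.symm hm.2, Ne.symm hk.1, Ne.symm hl.1, Ne.symm hm.1, hkl, hkm, hlm,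
    fun z => ?_⟩
  by_cases hza : z = a
  · exact Or.inl hza
  by_cases hzb : z = b
  · exact Or.inr (Or.inl hzb)
  have hz : z ∈ (Finset.univ.erase a).erase b := (memR z).mpr ⟨hzb, hza⟩
  rw [hRe] at hz
  simp only [Finset.mem_insert, Finset.mem_singleton] at hz
  rcases hz with h | h | h
  · exact Or.inr (Or.inr (Or.inl h))
  · exact Or.inr (Or.inr (Or.inr (Or.inl h)))
  · exact Or.inr (Or.inr (Or.inr (Or.inr h)))

/-- **Relations killing the pattern part are antisymmetric off the diagonal.** [folklore] -/
theorem antisym_of_pattern_relations (s : Fin 5 → Fin 5 → ℂ)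
    (h : ∀ c d e : Fin 5, ∑ x : Fin 5, ∑ y : Fin 5, s x y *
      (if (x ≠ y ∧ x ≠ c ∧ x ≠ d ∧ x ≠ e ∧ y ≠ c ∧ y ≠ d ∧ y ≠ e ∧ c ≠ d ∧ c ≠ e ∧ d ≠ e) then (1 : ℂ) else 0) = 0)
    (a b : Fin 5) (hab : a ≠ b) : s a b + s b a = 0 := by
  obtain ⟨c, d, e, hac, had, hae, hbc, hbd, hbe, hcd, hce, hde, hcover⟩ := exists_complement_triple a b hab
  have hev := pairSum_pattern_eval
    (fun x y c d e => if (x ≠ y ∧ x ≠ c ∧ x ≠ d ∧ x ≠ e ∧ y ≠ c ∧ y ≠ d ∧ y ≠ e ∧ c ≠ d ∧ c ≠ e ∧ d ≠ e) then (1 : ℂ) else 0)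
    s a b c d e hab hcover (fun x y hxy => pattern_zero_of_collision x y c d e hxy)
  rw [h c d e, if_pos ⟨hab, hac, had, hae, hbc, hbd, hbe, hcd, hce, hde⟩,
    if_pos ⟨Ne.symm hab, hbc, hbd, hbe, hac, had, hae, hcd, hce, hde⟩, mul_one, mul_one] at hev
  exact hev.symm

/-! ### The letter slack `E = H − (1/10)S_H` -/

/-- The slack is symmetric in slots `3,4`. [folklore] -/
theorem slack_symm34 (H : Fin 5 → Fin 5 → Fin 5 → Fin 5 → Fin 5 → ℂ)
    (h12 : ∀ a b c d e : Fin 5, H a b c d e = H b a c d e) (h34 : ∀ a b c d e : Fin 5, H a b c d e = H a b d c e)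
    (h45 : ∀ a b c d e : Fin 5, H a b c d e = H a b c e d) (A B C D E : Fin 5) :
    H A B C D E - (1 / 10 : ℂ) * (H A B C D E + H A C B D E + H A D B C E + H A E B C D + H B C A D E + H B D A C E
        + H B E A C D + H C D A B E + H C E A B D + H D E A B C)
      = H A B D C E - (1 / 10 : ℂ) * (H A B D C E + H A D B C E + H A C B D E + H A E B D C + H B D A C E + H B C A D E
        + H B E A D C + H D C A B E + H D E A B C + H C E A B D) := by
  rw [h34 A B D C E, h45 A E B D C, h45 B E A D C, h12 D C A B E]
  ring

/-- The slack is symmetric in slots `4,5`. [folklore] -/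
theorem slack_symm45 (H : Fin 5 → Fin 5 → Fin 5 → Fin 5 → Fin 5 → ℂ)
    (h12 : ∀ a b c d e : Fin 5, H a b c d e = H b a c d e) (h34 : ∀ a b c d e : Fin 5, H a b c d e = H a b d c e)
    (h45 : ∀ a b c d e : Fin 5, H a b c d e = H a b c e d) (A B C D E : Fin 5) :
    H A B C D E - (1 / 10 : ℂ) * (H A B C D E + H A C B D E + H A D B C E + H A E B C D + H B C A D E + H B D A C E
        + H B E A C D + H C D A B E + H C E A B D + H D E A B C)
      = H A B C E D - (1 / 10 : ℂ) * (H A B C E D + H A C B E D + H A E B C D + H A D B C E + H B C A E D + H B E A C D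
        + H B D A C E + H C E A B D + H C D A B E + H E D A B C) := by
  have _ := h34
  rw [h45 A B C E D, h45 A C B E D, h45 B C A E D, h12 E D A B C]
  ring

/-- **A T2 two-term tensor has a slack annihilated in its third slot by `{e,f}^⊥`.** [folklore] -/
theorem slack_annihilated_of_binary (U₁ U₂ : Fin 5 → Fin 5 → ℂ) (W₁ W₂ : Fin 5 → Fin 5 → Fin 5 → ℂ)
    (hU1 : ∀ a b : Fin 5, U₁ a b = U₁ b a) (hU2 : ∀ a b : Fin 5, U₂ a b = U₂ b a)
    (hW1a : ∀ a b c : Fin 5, W₁ a b c = W₁ b a c) (hW1b : ∀ a b c : Fin 5, W₁ a b c = W₁ a c b)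
    (hW2a : ∀ a b c : Fin 5, W₂ a b c = W₂ b a c) (hW2b : ∀ a b c : Fin 5, W₂ a b c = W₂ a c b)
    (e f : Fin 5 → ℂ)
    (hcol : ∀ d : Fin 5, (∃ s t : ℂ, ∀ x : Fin 5, U₁ x d = s * e x + t * f x) ∧ (∃ s t : ℂ, ∀ x : Fin 5, U₂ x d = s * e x + t * f x))
    (hW1 : ∀ v : Fin 5 → ℂ, ∑ x : Fin 5, v x * e x = 0 → ∑ x : Fin 5, v x * f x = 0 → ∀ b c : Fin 5, ∑ a : Fin 5, v a * W₁ a b c = 0)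
    (hW2 : ∀ v : Fin 5 → ℂ, ∑ x : Fin 5, v x * e x = 0 → ∑ x : Fin 5, v x * f x = 0 → ∀ b c : Fin 5, ∑ a : Fin 5, v a * W₂ a b c = 0)
    (H : Fin 5 → Fin 5 → Fin 5 → Fin 5 → Fin 5 → ℂ) (hH : ∀ x y z w u : Fin 5, H x y z w u = U₁ x y * W₁ z w u + U₂ x y * W₂ z w u)
    (v : Fin 5 → ℂ) (hve : ∑ x : Fin 5, v x * e x = 0) (hvf : ∑ x : Fin 5, v x * f x = 0) (A B D E' : Fin 5) :
    ∑ C' : Fin 5, v C' * (H A B C' D E' - (1 / 10 : ℂ) * (H A B C' D E' + H A C' B D E' + H A D B C' E' + H A E' B C' D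
      + H B C' A D E' + H B D A C' E' + H B E' A C' D + H C' D A B E' + H C' E' A B D + H D E' A B C')) = 0 := by
  -- contractions with `v`
  have cU1 : ∀ y : Fin 5, ∑ x : Fin 5, v x * U₁ x y = 0 := by
    intro y
    obtain ⟨⟨s, t, hst⟩, -⟩ := hcol y
    simp only [hst, mul_add, Finset.sum_add_distrib]
    have e1 : ∑ x : Fin 5, v x * (s * e x) = s * ∑ x : Fin 5, v x * e x := by
      rw [Finset.mul_sum]; exact Finset.sum_congr rfl fun x _ => by ring
    have e2 : ∑ x : Fin 5, v x * (t * f x) = t * ∑ x : Fin 5, v x * f x := by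
      rw [Finset.mul_sum]; exact Finset.sum_congr rfl fun x _ => by ring
    rw [e1, e2, hve, hvf, mul_zero, mul_zero, add_zero]
  have cU2 : ∀ y : Fin 5, ∑ x : Fin 5, v x * U₂ x y = 0 := by
    intro y
    obtain ⟨-, ⟨s, t, hst⟩⟩ := hcol y
    simp only [hst, mul_add, Finset.sum_add_distrib]
    have e1 : ∑ x : Fin 5, v x * (s * e x) = s * ∑ x : Fin 5, v x * e x := by
      rw [Finset.mul_sum]; exact Finset.sum_congr rfl fun x _ => by ring
    have e2 : ∑ x : Fin 5, v x * (t * f x) = t * ∑ x : Fin 5, v x * f x := by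
      rw [Finset.mul_sum]; exact Finset.sum_congr rfl fun x _ => by ring
    rw [e1, e2, hve, hvf, mul_zero, mul_zero, add_zero]
  have cW1 := hW1 v hve hvf
  have cW2 := hW2 v hve hvf
  -- generic vanishing: `Σ_C v_C (α·U_i(C,y)) = 0`, `Σ_C v_C (α·W_i(C,z,w)) = 0` in any slot
  have kU : ∀ (y : Fin 5) (α β : ℂ), ∑ x : Fin 5, v x * (U₁ x y * α + U₂ x y * β) = 0 := by
    intro y α β
    have h1 : ∑ x : Fin 5, v x * (U₁ x y * α + U₂ x y * β) = α * ∑ x : Fin 5, v x * U₁ x y + β * ∑ x : Fin 5, v x * U₂ x y := by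
      rw [Finset.mul_sum, Finset.mul_sum, ← Finset.sum_add_distrib]
      exact Finset.sum_congr rfl fun x _ => by ring
    rw [h1, cU1, cU2, mul_zero, mul_zero, add_zero]
  have kW : ∀ (z w : Fin 5) (α β : ℂ), ∑ x : Fin 5, v x * (α * W₁ x z w + β * W₂ x z w) = 0 := by
    intro z w α β
    have h1 : ∑ x : Fin 5, v x * (α * W₁ x z w + β * W₂ x z w) = α * ∑ x : Fin 5, v x * W₁ x z w + β * ∑ x : Fin 5, v x * W₂ x z w := by
      rw [Finset.mul_sum, Finset.mul_sum, ← Finset.sum_add_distrib]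
      exact Finset.sum_congr rfl fun x _ => by ring
    rw [h1, cW1, cW2, mul_zero, mul_zero, add_zero]
  -- each of the eleven terms, with the summation letter moved to the front of its factor
  have t0 : ∑ C' : Fin 5, v C' * H A B C' D E' = 0 := by
    simp only [hH]; simpa only [mul_comm] using kW D E' (U₁ A B) (U₂ A B)
  have t1 : ∑ C' : Fin 5, v C' * H A C' B D E' = 0 := by
    simp only [hH, hU1 A, hU2 A]; exact kU A (W₁ B D E') (W₂ B D E')
  have t2 : ∑ C' : Fin 5, v C' * H A D B C' E' = 0 := by
    simp only [hH, hW1a B, hW2a B]; simpa only [mul_comm] using kW B E' (U₁ A D) (U₂ A D)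
  have t3 : ∑ C' : Fin 5, v C' * H A E' B C' D = 0 := by
    simp only [hH, hW1a B, hW2a B]; simpa only [mul_comm] using kW B D (U₁ A E') (U₂ A E')
  have t4 : ∑ C' : Fin 5, v C' * H B C' A D E' = 0 := by
    simp only [hH, hU1 B, hU2 B]; exact kU B (W₁ A D E') (W₂ A D E')
  have t5 : ∑ C' : Fin 5, v C' * H B D A C' E' = 0 := by
    simp only [hH, hW1a A, hW2a A]; simpa only [mul_comm] using kW A E' (U₁ B D) (U₂ B D)
  have t6 : ∑ C' : Fin 5, v C' * H B E' A C' D = 0 := by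
    simp only [hH, hW1a A, hW2a A]; simpa only [mul_comm] using kW A D (U₁ B E') (U₂ B E')
  have t7 : ∑ C' : Fin 5, v C' * H C' D A B E' = 0 := by
    simp only [hH]; exact kU D (W₁ A B E') (W₂ A B E')
  have t8 : ∑ C' : Fin 5, v C' * H C' E' A B D = 0 := by
    simp only [hH]; exact kU E' (W₁ A B D) (W₂ A B D)
  have t9 : ∑ C' : Fin 5, v C' * H D E' A B C' = 0 := by
    have e1 : ∀ C' : Fin 5, H D E' A B C' = U₁ D E' * W₁ C' A B + U₂ D E' * W₂ C' A B := fun C' => by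
      rw [hH, hW1b A B C', hW1a A C' B, hW2b A B C', hW2a A C' B]
    simp only [e1]; simpa only [mul_comm] using kW A B (U₁ D E') (U₂ D E')
  have expand : ∀ C' : Fin 5, v C' * (H A B C' D E' - (1 / 10 : ℂ) * (H A B C' D E' + H A C' B D E' + H A D B C' E'
      + H A E' B C' D + H B C' A D E' + H B D A C' E' + H B E' A C' D + H C' D A B E' + H C' E' A B D + H D E' A B C'))
      = v C' * H A B C' D E' - (1 / 10 : ℂ) * (v C' * H A B C' D E' + v C' * H A C' B D E' + v C' * H A D B C' E'
        + v C' * H A E' B C' D + v C' * H B C' A D E' + v C' * H B D A C' E' + v C' * H B E' A C' D + v C' * H C' D A B E'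
        + v C' * H C' E' A B D + v C' * H D E' A B C') := fun C' => by ring
  simp only [expand, Finset.sum_sub_distrib, Finset.sum_add_distrib, ← Finset.mul_sum]
  rw [t0, t1, t2, t3, t4, t5, t6, t7, t8, t9]
  ring

/-! ### Letter relations → polynomial relations -/

/-- **A letter relation of `P₅ + 4E` is a polynomial relation** of `x^{{A,B}ᶜ} + (2/3)E_{AB}`. [folklore] -/
theorem poly_relation_of_letter_relation (s : Fin 5 → Fin 5 → ℂ) (EL : Fin 5 → Fin 5 → Fin 5 → Fin 5 → Fin 5 → ℂ)
    (Epoly : Fin 5 → Fin 5 → MvPolynomial (Fin 5) ℂ)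
    (hEpoly : ∀ A B : Fin 5, Epoly A B = ∑ c : Fin 5, ∑ d : Fin 5, ∑ e : Fin 5, C (EL A B c d e) * X c * X d * X e)
    (hrel : ∀ c d e : Fin 5, ∑ A : Fin 5, ∑ B : Fin 5, s A B *
      ((if (A ≠ B ∧ A ≠ c ∧ A ≠ d ∧ A ≠ e ∧ B ≠ c ∧ B ≠ d ∧ B ≠ e ∧ c ≠ d ∧ c ≠ e ∧ d ≠ e) then (1 : ℂ) else 0)
        + 4 * EL A B c d e) = 0) :
    (∑ A : Fin 5, ∑ B : Fin 5, C (s A B) *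
      ((if A = B then 0 else
        monomial (Finsupp.equivFunOnFinite.symm (fun z : Fin 5 => if z = A ∨ z = B then (0 : ℕ) else 1)) 1)
        + C (2 / 3 : ℂ) * Epoly A B) : MvPolynomial (Fin 5) ℂ) = 0 := by
  classical
  -- each summand is `(1/6)·Σ_{cde} C(s_{AB}(P + 4E)(A,B,c,d,e)) X_cX_dX_e`
  have hP : ∀ A B : Fin 5, (if A = B then (0 : MvPolynomial (Fin 5) ℂ) else
      monomial (Finsupp.equivFunOnFinite.symm (fun z : Fin 5 => if z = A ∨ z = B then (0 : ℕ) else 1)) 1)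
      = C (1 / 6 : ℂ) * ∑ c : Fin 5, ∑ d : Fin 5, ∑ e : Fin 5,
        C (if (A ≠ B ∧ A ≠ c ∧ A ≠ d ∧ A ≠ e ∧ B ≠ c ∧ B ≠ d ∧ B ≠ e ∧ c ≠ d ∧ c ≠ e ∧ d ≠ e) then (1 : ℂ) else 0)
          * X c * X d * X e := by
    intro A B
    by_cases hAB : A = B
    · subst hAB
      rw [if_pos rfl, pattern_cubic_diag, mul_zero]
    · rw [if_neg hAB, pattern_cubic A B hAB, ← mul_assoc, show (6 : MvPolynomial (Fin 5) ℂ) = C (6 : ℂ) from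
        (map_ofNat C 6).symm, ← map_mul]
      norm_num
  have hsummand : ∀ A B : Fin 5, (C (s A B) * ((if A = B then 0 else
      monomial (Finsupp.equivFunOnFinite.symm (fun z : Fin 5 => if z = A ∨ z = B then (0 : ℕ) else 1)) 1)
        + C (2 / 3 : ℂ) * Epoly A B) : MvPolynomial (Fin 5) ℂ)
      = ∑ c : Fin 5, ∑ d : Fin 5, ∑ e : Fin 5, C ((1 / 6 : ℂ) * (s A B *
        ((if (A ≠ B ∧ A ≠ c ∧ A ≠ d ∧ A ≠ e ∧ B ≠ c ∧ B ≠ d ∧ B ≠ e ∧ c ≠ d ∧ c ≠ e ∧ d ≠ e) then (1 : ℂ) else 0)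
          + 4 * EL A B c d e))) * X c * X d * X e := by
    intro A B
    rw [hP, hEpoly, Finset.mul_sum, Finset.mul_sum, mul_add, Finset.mul_sum, Finset.mul_sum, ← Finset.sum_add_distrib]
    refine Finset.sum_congr rfl fun c _ => ?_
    rw [Finset.mul_sum, Finset.mul_sum, Finset.mul_sum, Finset.mul_sum, ← Finset.sum_add_distrib]
    refine Finset.sum_congr rfl fun d _ => ?_
    rw [Finset.mul_sum, Finset.mul_sum, Finset.mul_sum, Finset.mul_sum, ← Finset.sum_add_distrib]
    refine Finset.sum_congr rfl fun e _ => ?_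
    simp only [map_mul, map_add, map_ofNat]
    have h6 : (C (2 / 3 : ℂ) : MvPolynomial (Fin 5) ℂ) = C (1 / 6 : ℂ) * 4 := by
      rw [show (4 : MvPolynomial (Fin 5) ℂ) = C (4 : ℂ) from (map_ofNat C 4).symm, ← map_mul]; norm_num
    rw [h6]
    ring
  simp only [hsummand]
  -- move the sum over `A, B` inside
  rw [Finset.sum_comm]
  have step : ∀ B : Fin 5, (∑ A : Fin 5, ∑ c : Fin 5, ∑ d : Fin 5, ∑ e : Fin 5, C ((1 / 6 : ℂ) * (s A B *
        ((if (A ≠ B ∧ A ≠ c ∧ A ≠ d ∧ A ≠ e ∧ B ≠ c ∧ B ≠ d ∧ B ≠ e ∧ c ≠ d ∧ c ≠ e ∧ d ≠ e) then (1 : ℂ) else 0)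
          + 4 * EL A B c d e))) * X c * X d * X e : MvPolynomial (Fin 5) ℂ)
      = ∑ c : Fin 5, ∑ d : Fin 5, ∑ e : Fin 5, ∑ A : Fin 5, C ((1 / 6 : ℂ) * (s A B *
        ((if (A ≠ B ∧ A ≠ c ∧ A ≠ d ∧ A ≠ e ∧ B ≠ c ∧ B ≠ d ∧ B ≠ e ∧ c ≠ d ∧ c ≠ e ∧ d ≠ e) then (1 : ℂ) else 0)
          + 4 * EL A B c d e))) * X c * X d * X e := by
    intro B
    rw [Finset.sum_comm]
    refine Finset.sum_congr rfl fun c _ => ?_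
    rw [Finset.sum_comm]
    refine Finset.sum_congr rfl fun d _ => ?_
    rw [Finset.sum_comm]
  simp only [step]
  rw [Finset.sum_comm]
  refine Finset.sum_eq_zero fun c _ => ?_
  rw [Finset.sum_comm]
  refine Finset.sum_eq_zero fun d _ => ?_
  rw [Finset.sum_comm]
  refine Finset.sum_eq_zero fun e _ => ?_
  have h := hrel c d e
  rw [Finset.sum_comm] at h
  have : ∑ B : Fin 5, ∑ A : Fin 5, (C ((1 / 6 : ℂ) * (s A B *
      ((if (A ≠ B ∧ A ≠ c ∧ A ≠ d ∧ A ≠ e ∧ B ≠ c ∧ B ≠ d ∧ B ≠ e ∧ c ≠ d ∧ c ≠ e ∧ d ≠ e) then (1 : ℂ) else 0)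
        + 4 * EL A B c d e))) * X c * X d * X e : MvPolynomial (Fin 5) ℂ)
      = C ((1 / 6 : ℂ) * ∑ B : Fin 5, ∑ A : Fin 5, s A B *
        ((if (A ≠ B ∧ A ≠ c ∧ A ≠ d ∧ A ≠ e ∧ B ≠ c ∧ B ≠ d ∧ B ≠ e ∧ c ≠ d ∧ c ≠ e ∧ d ≠ e) then (1 : ℂ) else 0)
          + 4 * EL A B c d e)) * X c * X d * X e := by
    rw [Finset.mul_sum, map_sum, Finset.sum_mul, Finset.sum_mul, Finset.sum_mul]
    refine Finset.sum_congr rfl fun B _ => ?_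
    rw [Finset.mul_sum, map_sum, Finset.sum_mul, Finset.sum_mul, Finset.sum_mul]
  rw [this, h, mul_zero, C_0, zero_mul, zero_mul, zero_mul]

end LaplaceFiveStar

end Summit.ValiantsHypothesis.ValiantsHypothesis.Theorems.RigidityForcesSymmetryRankRigidMinimalRepr
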